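import Summits.QuantumFields.BalabanUV.Beta.CompositeAveragingCoarseExactLevels
import Literature.MathematicalPhysics.QuantumFieldTheory.Balaban1983to89.Beta.AffineReproduction

/-!
# `BalabanUV.Beta.CompositeCorrectorForms` — binder row D1, work item K-U3d leaf L1: **THE (a1*)_m CORRECTORS AT FORM LEVEL** — the block-constant
# extension `ext n`, NILPOTENCY of the composite defect potential on block-constant pure gauges (`ζ_m (dz (ext (L^m) g)) = 0`), hence the correctors
# `Φ_m A = A − c•dz (ext n (ζ_m A))`, `Ψ_m A = A + c•dz (ext n (ζ_m A))` are MUTUALLY INVERSE, RE-LINEARISE the straight row to the composite one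
# (`contourSum n (Φ_m A) = compLinAvgAt r L m A`), PRESERVE THE ROOTED AXIAL (comb) SLICE, and are curvature-flat
# (β sub-cell, BINDER-OWNERS row D1 OWNER, lineage an2 gen 24; memo `HOME/b2b-balaban-beta-an2/gen24/K-U3d-SCOPE.v1.md` §2 L1; over an3-g37's K-U3b′
# `CompositeAveragingCoarseExactLevels` p240596 BY NAME)

HONEST FRAMING (cell charter, verbatim): «discharging BetaPertH makes Balaban's UV stability UNCONDITIONAL — a real
constructive-QFT result; it is NOT the continuum limit and NOT the Clay problem.»
HONEST DEPENDENCY: continuum YM on T⁴ ⇐ BetaPertH ∧ nine spine estimates (0/9 proved); BetaPertH ⇐ (D1) ∧ (D4) ∧ CAP+tail;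
G-an2-4 gates asym, D1 and NE2/3/4.
ABSOLUTE RULE (cell, verbatim): «No internally-minted statement may enter as a cited fact. Every hypothesis is either kernel-proved in this
package or a verbatim quotation of a PUBLISHED theorem with page reference. The manuscript(s) under audit are NOT citable for their own
disputed steps — they are the thing under adjudication; programme-internal (2001/route/tribunal) claims are never citable.»
NOTHING below is cited: no `[cite: …]`, no `Prop` fact.  Three DATA definitions ([our object]: `ext`, `corrPhi`, `corrPsi`) and [folklore] finite-difference algebra
over the cell's OWN typed objects BY NAME: the lead's `AffineAveraging.dz ∕ blockSum ∕ contourSum ∕ curv` (`contourSum_dz`, `curv_dz`), an1's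
`AveragingContours.blk ∕ axial ∕ grad` (`blk_block`, `axial_sum_grad`) and `AveragingContoursRooted.linAvgAt ∕ treeGaugeAt ∕ AxialGaugeAt` (`linAvgAt_sub`), an3-g37's
`CompositeAveragingCoarseExact.compLinAvgAt ∕ compDefectAt ∕ compRootPullback` (`compLinAvgAt_dz`, `linAvgAt_dz_eq_dz_pullback`, `contourSum_pow_eq_compLinAvgAt_add_dz`).
It asserts nothing about Bałaban's non-linear averages beyond their typed linearisations.

WHY (row-D1 owner, gen 24; RULING R-D1-g24-2; an3-g37 `A2-ENGINE-TERMS.v1.md` §1 (ii), §4 (5)(α), §7 (B)).  The composite one-shot dressing of record (a1*)_m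
conjugates the straight co-dressed resolvent by a corrector built from the potential `ζ_m = compDefectAt r L m` of the COARSE-EXACT defect
`contourSum (L^m) − compLinAvgAt r L m = dz ∘ ζ_m` (K-U3b′).  THIS FILE supplies, at Form level, exactly the identities the congruence lemmas K-U3a∕K-U3c
(`relInv_congr[_kernel]`) consume: the corrector pair is mutually inverse (nilpotency of `ζ_m` on block-constant pure gauges), it re-linearises the border
(`contourSum n ∘ Φ_m = compLinAvgAt`), it maps the rooted axial slice into itself (`Φ_m − 1`, `Ψ_m − 1` take values in exact forms of `n`-block-constant
functions, which have zero rooted tree gauge), and it is `curv`-flat (`curv ∘ Φ_m = curv`).  Kernelisation (L2), the kernel identities (L3) and the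
`RelInv` END (L4) are the sequels.

WHAT (`d` the lattice dimension; `L` the block side, `m` the number of levels, `n = L^m`; `r : ℕ → (Fin d → ℕ)` the root offsets; COUNT units; all [folklore]):
§1 [our object] `ext N g := g ∘ blk N`; `blockSum_ext`, `blk_blk`, `blk_pow_succ`, `ext_succ_apply`.
§2 `treeGaugeAt_dz_apply`, **`treeGaugeAt_dz_ext_succ`** ∕ **`treeGaugeAt_dz_ext`** (zero rooted tree gauge), **`axialGaugeAt_dz_ext`** (exact block-constant forms are rooted-axial).
§3 NILPOTENCY **`compLinAvgAt_dz_ext`** (`compLinAvgAt r L k (dz (ext (L^(j+k)) g)) = dz (ext (L^j) (|box L|^k • g))`), **`compDefectAt_dz_ext`** (`compDefectAt r L m (dz (ext (L^(j+m)) g)) = 0`).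
§4 SUBTRACTIVITY `treeGaugeAt_sub`, `blockSum_sub`, `compLinAvgAt_sub`, `compDefectAt_sub`.
§5 [our object] `corrPhi r L m`, `corrPsi r L m`; **`corrPsi_corrPhi`**, **`corrPhi_corrPsi`** (mutually inverse), **`contourSum_corrPhi`** (`= compLinAvgAt r L m`),
   **`axialGaugeAt_corrPhi_sub`** ∕ **`axialGaugeAt_corrPsi_sub`** (slice preservation), **`curv_corrPhi`** ∕ **`curv_corrPsi`** (flatness).
Provenance: β sub-cell, unit beta-an2 gen 24 (prover-b2b-balaban-beta-an2-g24-0), 2026-08-20.  NOT (SDF), NOT D1, NOT `BetaPertH`, NOT continuum, NOT Clay.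
-/

namespace Summit.QuantumFields.BalabanUV.Beta.CompositeCorrectorForms

open Finset
open scoped BigOperators
open Literature.MathematicalPhysics.QuantumFieldTheory.Balaban1983to89.Beta
open AffineAveraging (Site Form0 Form1 box toSite unitVec dz curv blockSum contourSum contourSum_dz curv_dz)
open AveragingContours (blk blk_block grad axial axial_sum_grad grad_eq_dz)
open AveragingContoursRooted (linAvgAt treeGaugeAt AxialGaugeAt linAvgAt_sub)
open AffineReproduction (dz_add dz_sub contourSum_sub)
open Summit.QuantumFields.BalabanUV.Beta.CompositeAveragingCoarseExact (compLinAvgAt compDefectAt compRootPullback compLinAvgAt_succ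
  compDefectAt_succ compLinAvgAt_dz linAvgAt_dz_eq_dz_pullback contourSum_pow_eq_compLinAvgAt_add_dz)

noncomputable section

variable {d : ℕ}

/-! ## §1 The block-constant extension -/

/-- [our object] The BLOCK-CONSTANT EXTENSION of a coarse 0-form: `ext N g x := g (blk N x)` (constant on `N`-blocks). -/
def ext (N : ℕ) (g : Form0 d ℝ) : Form0 d ℝ := fun x => g (blk N x)

/-- `ext N g x = g (blk N x)`. [folklore] -/
@[simp] theorem ext_apply (N : ℕ) (g : Form0 d ℝ) (x : Site d) : ext N g x = g (blk N x) := rfl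

/-- [folklore] The block sum of a block-constant extension: `blockSum N (ext N g) = |box| • g`. -/
theorem blockSum_ext (N : ℕ) (g : Form0 d ℝ) : blockSum N (ext N g) = ((box d N).card : ℝ) • g := by
  funext y
  simp only [blockSum, ext_apply, Pi.smul_apply, smul_eq_mul]
  rw [Finset.sum_congr rfl fun b hb => by rw [blk_block y hb], Finset.sum_const, nsmul_eq_mul]

/-- [folklore] Nested blocks: `blk (L^(j+1)) x = blk (L^j) (blk L x)` (`0 < L`). -/
theorem blk_blk {L : ℕ} (hL : 0 < L) (j : ℕ) (x : Site d) : blk (L ^ (j + 1)) x = blk (L ^ j) (blk L x) := by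
  funext i
  simp only [blk]
  push_cast
  rw [pow_succ', ← Int.ediv_ediv_of_nonneg (by exact_mod_cast hL.le : (0 : ℤ) ≤ (L : ℤ))]

/-- [folklore] `blk (L^(j+1)) (L•y + r) = blk (L^j) y` for an in-block offset `r`. -/
theorem blk_pow_succ {L : ℕ} (hL : 0 < L) {r : Fin d → ℕ} (hr : r ∈ box d L) (j : ℕ) (y : Site d) :
    blk (L ^ (j + 1)) ((L : ℤ) • y + toSite r) = blk (L ^ j) y := by
  rw [blk_blk hL, blk_block y hr]

/-- [folklore] `ext (L^(j+1)) g (L•y + r) = ext (L^j) g y`. -/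
theorem ext_succ_apply {L : ℕ} (hL : 0 < L) {r : Fin d → ℕ} (hr : r ∈ box d L) (j : ℕ) (g : Form0 d ℝ) (y : Site d) :
    ext (L ^ (j + 1)) g ((L : ℤ) • y + toSite r) = ext (L ^ j) g y := by
  rw [ext_apply, ext_apply, blk_pow_succ hL hr]

/-- [folklore] `ext (L^0) = id`. -/
@[simp] theorem ext_pow_zero (L : ℕ) (g : Form0 d ℝ) : ext (L ^ 0) g = g := by
  funext x
  simp only [ext, pow_zero]
  congr 1
  funext i
  simp [blk]

/-! ## §2 Exact block-constant forms have zero rooted tree gauge and are rooted-axial -/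

/-- [folklore] The rooted tree gauge of an exact form: `treeGaugeAt ρ (dz f) L x = f x − f (L•blk L x + ρ)`. -/
theorem treeGaugeAt_dz_apply (ρ : Site d) (f : Form0 d ℝ) (L : ℕ) (x : Site d) :
    treeGaugeAt ρ (dz f) L x = f x - f ((L : ℤ) • blk L x + ρ) := by
  rw [treeGaugeAt, ← grad_eq_dz, axial_sum_grad]

/-- [folklore] **ZERO ROOTED TREE GAUGE** for the exact form of a function constant on `L^(j+1)`-blocks (in-block root): `treeGaugeAt ρ (dz (ext (L^(j+1)) g)) L = 0`. -/
theorem treeGaugeAt_dz_ext_succ {L : ℕ} (hL : 0 < L) {r : Fin d → ℕ} (hr : r ∈ box d L) (j : ℕ) (g : Form0 d ℝ) :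
    treeGaugeAt (toSite r) (dz (ext (L ^ (j + 1)) g)) L = 0 := by
  funext x
  rw [treeGaugeAt_dz_apply, ext_succ_apply hL hr, ext_apply, ext_apply, blk_blk hL, sub_self]
  rfl

/-- [folklore] The same at the extension's own scale: `treeGaugeAt ρ (dz (ext N g)) N = 0` (in-block root). -/
theorem treeGaugeAt_dz_ext {N : ℕ} {r : Fin d → ℕ} (hr : r ∈ box d N) (g : Form0 d ℝ) :
    treeGaugeAt (toSite r) (dz (ext N g)) N = 0 := by
  funext x
  rw [treeGaugeAt_dz_apply, ext_apply, ext_apply, blk_block _ hr, sub_self]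
  rfl

/-- [folklore] **EXACT BLOCK-CONSTANT FORMS ARE ROOTED-AXIAL**: `AxialGaugeAt ρ (dz (ext N g)) N` (in-block root). -/
theorem axialGaugeAt_dz_ext {N : ℕ} {r : Fin d → ℕ} (hr : r ∈ box d N) (g : Form0 d ℝ) :
    AxialGaugeAt (toSite r) (dz (ext N g)) N := by
  intro y b hb
  rw [← grad_eq_dz, axial_sum_grad, ext_apply, ext_apply, blk_block y hb, blk_block y hr, sub_self]

/-- [folklore] Scalars pass through `dz ∘ ext`: `c • dz (ext N g) = dz (ext N (c • g))`. -/
theorem smul_dz_ext (c : ℝ) (N : ℕ) (g : Form0 d ℝ) : c • dz (ext N g) = dz (ext N (c • g)) := by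
  funext κ x; simp only [Pi.smul_apply, dz, ext_apply, smul_eq_mul]; ring

/-! ## §3 Nilpotency: the composite and its defect potential on block-constant pure gauges -/

/-- [folklore] **THE COMPOSITE OF A BLOCK-CONSTANT PURE GAUGE IS A (COARSER) BLOCK-CONSTANT PURE GAUGE**:
`compLinAvgAt r L k (dz (ext (L^(j+k)) g)) = dz (ext (L^j) (|box L|^k • g))` (in-block roots). -/
theorem compLinAvgAt_dz_ext {L : ℕ} (hL : 0 < L) (r : ℕ → (Fin d → ℕ)) (hr : ∀ k, r k ∈ box d L) (g : Form0 d ℝ) :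
    ∀ k j : ℕ, compLinAvgAt r L k (dz (ext (L ^ (j + k)) g)) = dz (ext (L ^ j) ((((box d L).card : ℝ) ^ k) • g))
  | 0, j => by simp [compLinAvgAt]
  | k + 1, j => by
      rw [compLinAvgAt_succ, show j + (k + 1) = (j + 1) + k by ring, compLinAvgAt_dz_ext hL r hr g k (j + 1)]
      funext μ y
      rw [linAvgAt_dz_eq_dz_pullback]
      congr 1
      funext y'
      rw [ext_succ_apply hL (hr k), ext_apply, ext_apply, Pi.smul_apply, Pi.smul_apply, smul_eq_mul, smul_eq_mul, pow_succ]
      ring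

/-- [folklore] `blockSum L 0 = 0`. -/
theorem blockSum_zero (L : ℕ) : blockSum L (0 : Form0 d ℝ) = 0 := by
  funext y; simp [blockSum]

/-- [folklore] **NILPOTENCY OF THE DEFECT POTENTIAL**: `compDefectAt r L m (dz (ext (L^(j+m)) g)) = 0` for all `m`, `j` (in-block roots) — every level's rooted tree
gauge sees an exact form constant on its own blocks. -/
theorem compDefectAt_dz_ext {L : ℕ} (hL : 0 < L) (r : ℕ → (Fin d → ℕ)) (hr : ∀ k, r k ∈ box d L) (g : Form0 d ℝ) :
    ∀ m j : ℕ, compDefectAt r L m (dz (ext (L ^ (j + m)) g)) = 0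
  | 0, j => rfl
  | m + 1, j => by
      rw [compDefectAt_succ, show j + (m + 1) = (j + 1) + m by ring, compDefectAt_dz_ext hL r hr g m (j + 1),
        compLinAvgAt_dz_ext hL r hr g m (j + 1), treeGaugeAt_dz_ext_succ hL (hr m), add_zero, blockSum_zero]

/-- [folklore] The case `j = 0`: `compDefectAt r L m (dz (ext (L^m) g)) = 0`. -/
theorem compDefectAt_dz_ext_self {L : ℕ} (hL : 0 < L) (r : ℕ → (Fin d → ℕ)) (hr : ∀ k, r k ∈ box d L) (g : Form0 d ℝ) (m : ℕ) :
    compDefectAt r L m (dz (ext (L ^ m) g)) = 0 := by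
  have h := compDefectAt_dz_ext hL r hr g m 0
  rwa [zero_add] at h

/-! ## §4 Subtractivity of the composite and of its defect potential -/

/-- [folklore] The rooted tree gauge is subtractive in the field. -/
theorem treeGaugeAt_sub (ρ : Site d) (A B : Form1 d ℝ) (L : ℕ) : treeGaugeAt ρ (A - B) L = treeGaugeAt ρ A L - treeGaugeAt ρ B L := by
  funext x
  simp only [treeGaugeAt, Pi.sub_apply, AveragingContours.axial_sum_sub]

/-- [folklore] `blockSum` is subtractive. -/
theorem blockSum_sub (L : ℕ) (f g : Form0 d ℝ) : blockSum L (f - g) = blockSum L f - blockSum L g := by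
  funext y; simp only [blockSum, Pi.sub_apply, Finset.sum_sub_distrib]

/-- [folklore] `linAvgAt` is subtractive as a 1-form. -/
theorem linAvgAt_sub' (ρ : Site d) (A B : Form1 d ℝ) (L : ℕ) :
    (linAvgAt ρ (A - B) L : Form1 d ℝ) = linAvgAt ρ A L - linAvgAt ρ B L := by
  funext μ y
  rw [Pi.sub_apply, Pi.sub_apply]
  exact linAvgAt_sub ρ A B L μ y

/-- [folklore] **THE COMPOSITE IS SUBTRACTIVE.** -/
theorem compLinAvgAt_sub (r : ℕ → (Fin d → ℕ)) (L : ℕ) (A B : Form1 d ℝ) :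
    ∀ m, compLinAvgAt r L m (A - B) = compLinAvgAt r L m A - compLinAvgAt r L m B
  | 0 => rfl
  | m + 1 => by rw [compLinAvgAt_succ, compLinAvgAt_succ, compLinAvgAt_succ, compLinAvgAt_sub r L A B m, linAvgAt_sub']

/-- [folklore] **THE DEFECT POTENTIAL IS SUBTRACTIVE.** -/
theorem compDefectAt_sub (r : ℕ → (Fin d → ℕ)) (L : ℕ) (A B : Form1 d ℝ) :
    ∀ m, compDefectAt r L m (A - B) = compDefectAt r L m A - compDefectAt r L m B
  | 0 => by simp [compDefectAt]
  | m + 1 => by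
      rw [compDefectAt_succ, compDefectAt_succ, compDefectAt_succ, compDefectAt_sub r L A B m, compLinAvgAt_sub, treeGaugeAt_sub,
        ← blockSum_sub]
      congr 1
      abel

/-! ## §5 The correctors -/

/-- [our object] THE (a1*)_m CORRECTOR ON THE BORDER SIDE: `Φ_m A := A − |box n|⁻¹ • dz (ext n (ζ_m A))`, `n = L^m`, `ζ_m = compDefectAt r L m`. -/
def corrPhi (r : ℕ → (Fin d → ℕ)) (L m : ℕ) (A : Form1 d ℝ) : Form1 d ℝ :=
  A - ((box d (L ^ m)).card : ℝ)⁻¹ • dz (ext (L ^ m) (compDefectAt r L m A))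

/-- [our object] ITS INVERSE (the dressing-side corrector): `Ψ_m A := A + |box n|⁻¹ • dz (ext n (ζ_m A))`. -/
def corrPsi (r : ℕ → (Fin d → ℕ)) (L m : ℕ) (A : Form1 d ℝ) : Form1 d ℝ :=
  A + ((box d (L ^ m)).card : ℝ)⁻¹ • dz (ext (L ^ m) (compDefectAt r L m A))

/-- [folklore] The defect potential does not see the correction term: `ζ_m (c • dz (ext n (ζ_m A))) = 0`. -/
theorem compDefectAt_corr_term {L : ℕ} (hL : 0 < L) (r : ℕ → (Fin d → ℕ)) (hr : ∀ k, r k ∈ box d L) (m : ℕ) (c : ℝ) (h : Form0 d ℝ) :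
    compDefectAt r L m (c • dz (ext (L ^ m) h)) = 0 := by
  rw [smul_dz_ext, compDefectAt_dz_ext_self hL r hr]

/-- [folklore] `ζ_m (Φ_m A) = ζ_m A`. -/
theorem compDefectAt_corrPhi {L : ℕ} (hL : 0 < L) (r : ℕ → (Fin d → ℕ)) (hr : ∀ k, r k ∈ box d L) (m : ℕ) (A : Form1 d ℝ) :
    compDefectAt r L m (corrPhi r L m A) = compDefectAt r L m A := by
  rw [corrPhi, compDefectAt_sub, compDefectAt_corr_term hL r hr, sub_zero]

/-- [folklore] `ζ_m (Ψ_m A) = ζ_m A`. -/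
theorem compDefectAt_corrPsi {L : ℕ} (hL : 0 < L) (r : ℕ → (Fin d → ℕ)) (hr : ∀ k, r k ∈ box d L) (m : ℕ) (A : Form1 d ℝ) :
    compDefectAt r L m (corrPsi r L m A) = compDefectAt r L m A := by
  have h : corrPsi r L m A = A - (-(((box d (L ^ m)).card : ℝ)⁻¹) • dz (ext (L ^ m) (compDefectAt r L m A))) := by
    rw [corrPsi, neg_smul, sub_neg_eq_add]
  rw [h, compDefectAt_sub, compDefectAt_corr_term hL r hr, sub_zero]

/-- [folklore] **THE CORRECTORS ARE MUTUALLY INVERSE (I)**: `Ψ_m (Φ_m A) = A`. -/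
theorem corrPsi_corrPhi {L : ℕ} (hL : 0 < L) (r : ℕ → (Fin d → ℕ)) (hr : ∀ k, r k ∈ box d L) (m : ℕ) (A : Form1 d ℝ) :
    corrPsi r L m (corrPhi r L m A) = A := by
  rw [corrPsi, compDefectAt_corrPhi hL r hr, corrPhi, sub_add_cancel]

/-- [folklore] **THE CORRECTORS ARE MUTUALLY INVERSE (II)**: `Φ_m (Ψ_m A) = A`. -/
theorem corrPhi_corrPsi {L : ℕ} (hL : 0 < L) (r : ℕ → (Fin d → ℕ)) (hr : ∀ k, r k ∈ box d L) (m : ℕ) (A : Form1 d ℝ) :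
    corrPhi r L m (corrPsi r L m A) = A := by
  rw [corrPhi, compDefectAt_corrPsi hL r hr, corrPsi, add_sub_cancel_right]

/-- [folklore] `contourSum` of a scalar multiple. -/
theorem contourSum_smul' (N : ℕ) (c : ℝ) (A : Form1 d ℝ) : contourSum N (c • A) = c • contourSum N A := by
  funext κ y; simp only [contourSum, Pi.smul_apply, smul_eq_mul, Finset.mul_sum]

/-- [folklore] **RE-LINEARISATION OF THE BORDER**: `contourSum (L^m) (Φ_m A) = compLinAvgAt r L m A` — the straight row of the corrected field IS the composite
linearised averaging of the field (`0 < L`). -/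
theorem contourSum_corrPhi {L : ℕ} (hL : 0 < L) (r : ℕ → (Fin d → ℕ)) (m : ℕ) (A : Form1 d ℝ) :
    contourSum (L ^ m) (corrPhi r L m A) = compLinAvgAt r L m A := by
  have hcard : ((box d (L ^ m)).card : ℝ) ≠ 0 := by
    have : 0 < (box d (L ^ m)).card := by
      rw [Finset.card_pos]
      exact ⟨fun _ => 0, Fintype.mem_piFinset.2 fun _ => Finset.mem_range.2 (pow_pos hL m)⟩
    exact_mod_cast this.ne'
  rw [corrPhi, contourSum_sub, contourSum_smul', contourSum_dz, blockSum_ext, contourSum_pow_eq_compLinAvgAt_add_dz hL r A m]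
  have e : ((box d (L ^ m)).card : ℝ)⁻¹ • dz (((box d (L ^ m)).card : ℝ) • compDefectAt r L m A) = dz (compDefectAt r L m A) := by
    funext κ y; simp only [Pi.smul_apply, dz, smul_eq_mul]; field_simp
  rw [e, add_sub_cancel_right]

/-- [folklore] **SLICE PRESERVATION (Φ)**: `Φ_m A − A` is rooted-axial at scale `n = L^m` for any in-block root — so `Φ_m` maps the rooted axial (comb) slice into itself. -/
theorem axialGaugeAt_corrPhi_sub (r : ℕ → (Fin d → ℕ)) (L m : ℕ) {s : Fin d → ℕ} (hs : s ∈ box d (L ^ m)) (A : Form1 d ℝ) :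
    AxialGaugeAt (toSite s) (corrPhi r L m A - A) (L ^ m) := by
  intro y b hb
  have h := axialGaugeAt_dz_ext hs (-(((box d (L ^ m)).card : ℝ)⁻¹) • compDefectAt r L m A) y b hb
  rw [← smul_dz_ext] at h
  have e : corrPhi r L m A - A = (-(((box d (L ^ m)).card : ℝ)⁻¹)) • dz (ext (L ^ m) (compDefectAt r L m A)) := by
    rw [corrPhi, neg_smul]; abel
  rw [e]; exact h

/-- [folklore] **SLICE PRESERVATION (Ψ)**: `Ψ_m A − A` is rooted-axial at scale `n = L^m`. -/
theorem axialGaugeAt_corrPsi_sub (r : ℕ → (Fin d → ℕ)) (L m : ℕ) {s : Fin d → ℕ} (hs : s ∈ box d (L ^ m)) (A : Form1 d ℝ) :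
    AxialGaugeAt (toSite s) (corrPsi r L m A - A) (L ^ m) := by
  intro y b hb
  have h := axialGaugeAt_dz_ext hs ((((box d (L ^ m)).card : ℝ)⁻¹) • compDefectAt r L m A) y b hb
  rw [← smul_dz_ext] at h
  have e : corrPsi r L m A - A = (((box d (L ^ m)).card : ℝ)⁻¹) • dz (ext (L ^ m) (compDefectAt r L m A)) := by
    rw [corrPsi]; abel
  rw [e]; exact h

/-- [folklore] `curv` is subtractive and homogeneous (pointwise linear). -/
theorem curv_sub_smul_dz (A : Form1 d ℝ) (c : ℝ) (f : Form0 d ℝ) : curv (A - c • dz f) = curv A := by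
  have h0 := curv_dz f
  funext μ ν x
  have h0' := congrFun (congrFun (congrFun h0 μ) ν) x
  simp only [curv, Pi.sub_apply, Pi.smul_apply, smul_eq_mul, Pi.zero_apply] at h0' ⊢
  linear_combination (-c) * h0'

/-- [folklore] **FLATNESS (Φ)**: `curv (Φ_m A) = curv A` — the fine Wilson Hessian `curvAdj ∘ curv` does not see the corrector. -/
theorem curv_corrPhi (r : ℕ → (Fin d → ℕ)) (L m : ℕ) (A : Form1 d ℝ) : curv (corrPhi r L m A) = curv A := by
  rw [corrPhi]; exact curv_sub_smul_dz A _ _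

/-- [folklore] **FLATNESS (Ψ)**: `curv (Ψ_m A) = curv A`. -/
theorem curv_corrPsi (r : ℕ → (Fin d → ℕ)) (L m : ℕ) (A : Form1 d ℝ) : curv (corrPsi r L m A) = curv A := by
  have h : corrPsi r L m A = A - (-(((box d (L ^ m)).card : ℝ)⁻¹)) • dz (ext (L ^ m) (compDefectAt r L m A)) := by
    rw [corrPsi, neg_smul, sub_neg_eq_add]
  rw [h]; exact curv_sub_smul_dz A _ _

end

end Summit.QuantumFields.BalabanUV.Beta.CompositeCorrectorForms
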